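import Summits.HodgeConjecture.CorCM.MumfordTateRankRibetTypeOne
import Summits.HodgeConjecture.CorCM.LefschetzAlgebraTotallyRealField
import Literature.AlgebraicGeometry.HodgeTheory.SimpleAbelianThreefoldPowersHodgeClasses
import Literature.AlgebraicGeometry.ComplexMultiplication.EndAlgebraCommutativeDegree
import HarnessLib

/-!
# The Mumford–Tate rank of every SIMPLE complex abelian THREEFOLD, by endomorphism type: `22`, `10`, `10`, `4`;
# Hodge = Lefschetz for every simple threefold (Moonen–Zarhin 1999 (2.3): `Hg(X) = Sp_D(V, φ)` for `g = 3`)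

COR-CM (cell `pub-hodgecm2`, seat `b27` gen 46, count-neutral Mumford–Tate-rank ladder; theorems only, no definition, no named fact;
UNCONDITIONAL — nothing here uses or asserts HC_CM).  The threefold companion of `CorCM/MumfordTateRankSimpleSurfacesSharp`.  For a SIMPLE
complex abelian threefold `A`, `dim_ℚ End⁰A ∈ {1, 2, 3, 6}` (`HodgeTheory/SimpleAbelianThreefoldCubicEndPowersHodgeClasses`) and
`t = dim MT(H¹A)` is:

* **`dim End⁰A = 1` (I(1), `End⁰A = ℚ`): `t = 22`**, `Lie Hg(H¹A) = 𝔰𝔭(H¹A, ψ)` of dimension `21` — the Lie step «`Hg = Sp_{6,ℚ}`» is the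
  tree's `mem_hodgeLie_iff_skew_of_threefold_endRankOne` (cell `pub-hodge-ring2`, the rank-six Θ-subalgebra theorem); NO simplicity needed
  (`mtRank_hodge_one_eq_twentytwo_of_threefold_of_finrank_endAlgebra_eq_one`);
* **`dim End⁰A = 2` (IV(1,1), imaginary quadratic): `t = 10`** (`Hg = U_F(V, ψ)`, `CorCM/MumfordTateRankRibetTypeOne`);
* **`dim End⁰A = 3` (I(3), totally real cubic): `t = 10`** (`Hg = R_{F/ℚ} SL₂`, dimension `9`; Ribet's rank formula
  `HodgeTheory/RealMultiplicationMumfordTateRank`);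
* **`dim End⁰A = 6` (IV(3,1), CM sextic): `t = 4`** (CM type, nondegenerate in dimension `≤ 3`, Pohlmann/Ribet 1980);
* **`mtRank_hodge_one_of_isSimple_threefold`** — the table; **`t ∈ {4, 10, 22}`**; `t = 22 ⟺ End⁰A = ℚ`; `t = 4 ⟺ dim End⁰A = 6 ⟺` CM;
* **`hodgeLie_eq_lefschetz_of_isSimple_threefold`** — **HODGE = LEFSCHETZ `Lie Hg(H¹A) = C(End_Hdg(H¹A)) ∩ 𝔰𝔭(ψ)` for EVERY simple complex
  abelian threefold and every polarization** (Moonen–Zarhin (2.3)/(2.5): `Hg(X) = Sp_D(V, φ)` in all four cases, at the level of Lie algebras).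

## References
* [MoonenZarhin1999LowDim] B. Moonen, Yu. G. Zarhin, *Hodge classes on abelian varieties of low dimension*, Math. Ann. 315 (1999), §2 (2.3),
  (2.4), Prop. (2.5).
* [Ribet1983] K. A. Ribet, Amer. J. Math. 105 (1983), Thm. 0–1, Thm. 3.
* [Ribet1980] K. A. Ribet, *Division fields of abelian varieties with complex multiplication*, Mém. SMF 2 (1980), §3 (3.7).
* [Milne1999LefschetzClasses] J. S. Milne, Compositio Math. 117 (1999), §2 and Summary.
* [MumfordAV1970] D. Mumford, *Abelian Varieties*, §19 Cor. 2 of Thm. 1, §21 Thm. 2.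
-/

noncomputable section

open scoped TensorProduct
open CategoryTheory Module NumberField

namespace Summit.HodgeConjecture.CorCM

open Literature.AlgebraicGeometry.Motives
open Literature.AlgebraicGeometry.Motives.AbelianVariety
open Literature.AlgebraicGeometry.Motives.HodgeStructure
open Literature.AlgebraicGeometry.HodgeTheory
open Literature.AlgebraicGeometry.ComplexMultiplication
open Literature.AlgebraicGeometry.Milne1999 (IsOfCMType)
open Literature.Algebra.Lie

variable [HodgeTensorFacts.{0, 0}] {A : AbelianVariety ℂ}

/-! ## §1 `End⁰A = ℚ`: `Lie Hg(H¹A) = 𝔰𝔭₆`, `t = 22` -/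

/-- **An abelian THREEFOLD with `dim_ℚ End⁰A = 1` has `Lie Hg(H¹A) = 𝔰𝔭(H¹A, ψ)`** for every polarization (Moonen–Zarhin (2.3) Type I(1)
«`Hg(X) = Sp(V, φ) ≅ Sp_{6,ℚ}`», Lie form: the tree's `mem_hodgeLie_iff_skew_of_threefold_endRankOne`, read in the ladder's model).
[cite: MoonenZarhin1999LowDim, §2 (2.3)] -/
theorem hodgeLie_eq_skewAdjoint_of_threefold_of_finrank_endAlgebra_eq_one {k : ℕ} (hX : IsSmoothProjective k A.X) (h3 : A.dim = 3)
    (hE1 : Module.finrank ℚ A.endAlgebra = 1) [Module.Finite ℚ (bettiCohomology A.X 1)]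
    (ψ : (BettiUniverse.hodge exists_isReal_hodgeModel_holds hX 1).Polarization) :
    (BettiUniverse.hodge exists_isReal_hodgeModel_holds hX 1).hodgeLie = ψ.form.skewAdjointSubmodule := by
  have hk : A.dim = k := schemeDim_eq_holds hX
  subst hk
  ext Y
  rw [mem_hodgeLie_iff_skew_of_threefold_endRankOne exists_isReal_hodgeModel_holds hodgePQ_independent_of_hodgeModel_holds hE1 h3 ψ Y,
    LinearMap.mem_skewAdjointSubmodule]
  refine ⟨fun h v w => ?_, fun h v w => ?_⟩
  · rw [Pi.neg_apply, map_neg, ← add_eq_zero_iff_eq_neg]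
    exact h v w
  · have h' := h v w
    rw [Pi.neg_apply, map_neg, ← add_eq_zero_iff_eq_neg] at h'
    exact h'

/-- **An abelian THREEFOLD with `dim_ℚ End⁰A = 1` has `dim MT(H¹A) = 22` and `dim Lie Hg(H¹A) = 21`** (`Hg = Sp₆`, `dim 𝔰𝔭₆ = 3·7`; no
simplicity hypothesis needed). [cite: MoonenZarhin1999LowDim, §2 (2.3)] [cite: Humphreys1972, §1.2] -/
theorem mtRank_hodge_one_eq_twentytwo_of_threefold_of_finrank_endAlgebra_eq_one {k : ℕ} (hX : IsSmoothProjective k A.X)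
    (h3 : A.dim = 3) (hE1 : Module.finrank ℚ A.endAlgebra = 1) :
    haveI := BettiUniverse.finite hX 1
    (BettiUniverse.hodge exists_isReal_hodgeModel_holds hX 1).mtRank = 22 ∧
      Module.finrank ℚ (BettiUniverse.hodge exists_isReal_hodgeModel_holds hX 1).hodgeLie = 21 := by
  classical
  haveI := BettiUniverse.finite hX 1
  have h0 : 0 < A.dim := by omega
  obtain ⟨ψ⟩ := BettiUniverse.hodge_isPolarizable exists_isReal_hodgeModel_holds hX 1
  have hflip : ψ.form.flip = -ψ.form := by
    rw [ψ.flip_form, show (((1 : ℕ) : ℤ).negOnePow : ℤˣ) = -1 from Int.negOnePow_one, Units.val_neg, Units.val_one,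
      neg_one_zsmul]
  have hs := SymplecticDimension.two_mul_finrank_skewAdjointSubmodule_of_flip_eq_neg ψ.form ψ.nondegenerate hflip
  rw [finrank_bettiCohomology_one_eq_two_mul_dim A, h3] at hs
  have h21 : Module.finrank ℚ (BettiUniverse.hodge exists_isReal_hodgeModel_holds hX 1).hodgeLie = 21 := by
    rw [hodgeLie_eq_skewAdjoint_of_threefold_of_finrank_endAlgebra_eq_one hX h3 hE1 ψ]
    omega
  rw [mtRank_hodge_one_eq_finrank_hodgeLie_add_one hX h0, h21]
  exact ⟨rfl, rfl⟩

/-- **Hodge = Lefschetz for a threefold with `End⁰A = ℚ`**: `Lie Hg(H¹A) = C(End_Hdg(H¹A)) ∩ 𝔰𝔭(ψ) = 𝔰𝔭(ψ)`.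
[cite: MoonenZarhin1999LowDim, §2 (2.3)] [cite: Milne1999LefschetzClasses, §2 and Summary] -/
theorem hodgeLie_eq_lefschetz_of_threefold_of_finrank_endAlgebra_eq_one {k : ℕ} (hX : IsSmoothProjective k A.X) (h3 : A.dim = 3)
    (hE1 : Module.finrank ℚ A.endAlgebra = 1) [Module.Finite ℚ (bettiCohomology A.X 1)]
    (ψ : (BettiUniverse.hodge exists_isReal_hodgeModel_holds hX 1).Polarization) :
    (BettiUniverse.hodge exists_isReal_hodgeModel_holds hX 1).hodgeLie =
      Subalgebra.toSubmodule (Subalgebra.centralizer ℚ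
          ((BettiUniverse.hodge exists_isReal_hodgeModel_holds hX 1).endAlg : Set (Module.End ℚ (bettiCohomology A.X 1)))) ⊓
        ψ.form.skewAdjointSubmodule := by
  refine le_antisymm (hodgeLie_hodge_one_le_lefschetz hX ψ) ?_
  rw [hodgeLie_eq_skewAdjoint_of_threefold_of_finrank_endAlgebra_eq_one hX h3 hE1 ψ]
  exact inf_le_right

/-! ## §2 `End⁰A` a totally real cubic field: `t = 10` (Ribet: `Hg = R_{F/ℚ} SL₂`) -/

/-- **A simple abelian THREEFOLD with `dim_ℚ End⁰A = 3` has `dim MT(H¹A) = 10` and `dim Lie Hg(H¹A) = 9`** (`End⁰A` is a field — a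
three-dimensional division algebra over `ℚ` is commutative — and totally real (odd degree), so Ribet's `t = 3 dim A + 1` applies).
[cite: Ribet1983, Thm. 0–1] [cite: MoonenZarhin1999LowDim, §2 (2.3)] [cite: MumfordAV1970, §19 Cor. 2 of Thm. 1] -/
theorem mtRank_hodge_one_of_isSimple_threefold_of_finrank_endAlgebra_eq_three {k : ℕ} (hX : IsSmoothProjective k A.X)
    (hA : A.IsSimple) (h3 : A.dim = 3) (hE3 : Module.finrank ℚ A.endAlgebra = 3) :
    haveI := BettiUniverse.finite hX 1
    (BettiUniverse.hodge exists_isReal_hodgeModel_holds hX 1).mtRank = 10 ∧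
      Module.finrank ℚ (BettiUniverse.hodge exists_isReal_hodgeModel_holds hX 1).hodgeLie = 9 := by
  have h0 : 0 < A.dim := by omega
  have hF : IsField A.endAlgebra := AbelianVariety.isField_endAlgebra_of_isSimple_of_finrank_eq_three hA h0 hE3
  haveI : IsTotallyReal (EndField A hF) := AbelianVariety.isTotallyReal_endField_of_finrank_odd h0 hF (by rw [hE3]; decide)
  have h := mtRank_hodge_one_of_isTotallyReal' hF hX (by rw [hE3, h3])
  rw [h3] at h
  exact h

/-- **Hodge = Lefschetz for a simple threefold with totally real cubic multiplication** (real multiplication of relative dimension one).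
[cite: Ribet1983, Thm. 0–1] [cite: Milne1999LefschetzClasses, §2 and Summary] -/
theorem hodgeLie_eq_lefschetz_of_isSimple_threefold_of_finrank_endAlgebra_eq_three {k : ℕ} (hX : IsSmoothProjective k A.X)
    (hA : A.IsSimple) (h3 : A.dim = 3) (hE3 : Module.finrank ℚ A.endAlgebra = 3) [Module.Finite ℚ (bettiCohomology A.X 1)]
    (ψ : (BettiUniverse.hodge exists_isReal_hodgeModel_holds hX 1).Polarization) :
    (BettiUniverse.hodge exists_isReal_hodgeModel_holds hX 1).hodgeLie =
      Subalgebra.toSubmodule (Subalgebra.centralizer ℚ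
          ((BettiUniverse.hodge exists_isReal_hodgeModel_holds hX 1).endAlg : Set (Module.End ℚ (bettiCohomology A.X 1)))) ⊓
        ψ.form.skewAdjointSubmodule := by
  have h0 : 0 < A.dim := by omega
  have hF : IsField A.endAlgebra := AbelianVariety.isField_endAlgebra_of_isSimple_of_finrank_eq_three hA h0 hE3
  haveI : IsTotallyReal (EndField A hF) := AbelianVariety.isTotallyReal_endField_of_finrank_odd h0 hF (by rw [hE3]; decide)
  letI : Algebra (EndField A hF) A.endAlgebra := (EndField.toEndAlgebra hF).toRingHom.toAlgebra' fun c x => hF.mul_comm _ _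
  haveI : IsScalarTower ℚ (EndField A hF) A.endAlgebra := IsScalarTower.of_algebraMap_eq' (Subsingleton.elim _ _)
  have hK : Function.Bijective (algebraMap (EndField A hF) A.endAlgebra) := (EndField.toEndAlgebra hF).bijective
  exact hodgeLie_hodge_one_eq_lefschetz_of_field_of_dim_eq hX hK (by rw [EndField.finrank_eq, hE3, h3]) ψ

/-! ## §3 `End⁰A` a CM sextic field: `t = 4` -/

omit [HodgeTensorFacts.{0, 0}] in
/-- A simple threefold with `dim_ℚ End⁰A = 6` is of CM type (a six-dimensional division algebra over `ℚ` is commutative; degree `2 dim A`).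
[cite: MumfordAV1970, §19 Cor. 2 of Thm. 1] [cite: MoonenZarhin1999LowDim, §2 (2.3)] -/
theorem isOfCMType_of_isSimple_threefold_of_finrank_endAlgebra_eq_six (hA : A.IsSimple) (h3 : A.dim = 3)
    (hE6 : Module.finrank ℚ A.endAlgebra = 6) : IsOfCMType A :=
  (isOfCMType_iff_finrank_eq_of_comm (AbelianVariety.mul_comm_endAlgebra_of_isSimple_of_finrank_eq_six hA hE6)).2 (by rw [hE6, h3])

/-- **A simple abelian THREEFOLD with `dim_ℚ End⁰A = 6` has `dim MT(H¹A) = 4` and `dim Lie Hg(H¹A) = 3`** (CM type by a sextic CM field;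
simple CM threefolds are nondegenerate: `t = dim A + 1`, Ribet 1980 (3.7), the tree's `Pohlmann1968.mtRank_hodge_one_eq_of_dim_le_three`).
[cite: Ribet1980, §3 Examples (3.7) (p. 87)] [cite: MoonenZarhin1999LowDim, §2 (2.3)] -/
theorem mtRank_hodge_one_of_isSimple_threefold_of_finrank_endAlgebra_eq_six {k : ℕ} (hX : IsSmoothProjective k A.X)
    (hA : A.IsSimple) (h3 : A.dim = 3) (hE6 : Module.finrank ℚ A.endAlgebra = 6) :
    haveI := BettiUniverse.finite hX 1
    (BettiUniverse.hodge exists_isReal_hodgeModel_holds hX 1).mtRank = 4 ∧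
      Module.finrank ℚ (BettiUniverse.hodge exists_isReal_hodgeModel_holds hX 1).hodgeLie = 3 := by
  haveI := BettiUniverse.finite hX 1
  have h0 : 0 < A.dim := by omega
  have hcm := isOfCMType_of_isSimple_threefold_of_finrank_endAlgebra_eq_six hA h3 hE6
  have ht := Literature.AlgebraicGeometry.Pohlmann1968.mtRank_hodge_one_eq_of_dim_le_three hX hA h0 (by omega) hcm
  have hH := mtRank_hodge_one_eq_finrank_hodgeLie_add_one hX h0
  rw [h3] at ht
  constructor <;> omega

/-- **Hodge = Lefschetz for a simple CM threefold** (`dim_ℚ End⁰A = 6`): the tree's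
`hodgeLie_eq_lefschetz_of_isSimple_of_isOfCMType_of_dim_le_three_or_prime`, read with an arbitrary smooth-projective witness.
[cite: Ribet1980, §3 Examples (3.7) (p. 87)] [cite: Milne1999LefschetzClasses, §2 and Summary] -/
theorem hodgeLie_eq_lefschetz_of_isSimple_threefold_of_finrank_endAlgebra_eq_six {k : ℕ} (hX : IsSmoothProjective k A.X)
    (hA : A.IsSimple) (h3 : A.dim = 3) (hE6 : Module.finrank ℚ A.endAlgebra = 6) [Module.Finite ℚ (bettiCohomology A.X 1)]
    (ψ : (BettiUniverse.hodge exists_isReal_hodgeModel_holds hX 1).Polarization) :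
    (BettiUniverse.hodge exists_isReal_hodgeModel_holds hX 1).hodgeLie =
      Subalgebra.toSubmodule (Subalgebra.centralizer ℚ
          ((BettiUniverse.hodge exists_isReal_hodgeModel_holds hX 1).endAlg : Set (Module.End ℚ (bettiCohomology A.X 1)))) ⊓
        ψ.form.skewAdjointSubmodule := by
  have hk : A.dim = k := schemeDim_eq_holds hX
  subst hk
  exact hodgeLie_eq_lefschetz_of_isSimple_of_isOfCMType_of_dim_le_three_or_prime hA (by omega)
    (isOfCMType_of_isSimple_threefold_of_finrank_endAlgebra_eq_six hA h3 hE6) (Or.inl h3.le) ψ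

/-! ## §4 The table, and Hodge = Lefschetz for every simple threefold -/

/-- **THE MUMFORD–TATE RANK OF A SIMPLE COMPLEX ABELIAN THREEFOLD, BY ENDOMORPHISM TYPE** (Moonen–Zarhin (2.3)):
`End⁰A = ℚ ↦ 22` (`Sp₆`), imaginary quadratic `↦ 10` (`U(2,1)`), totally real cubic `↦ 10` (`R_{F/ℚ} SL₂`), CM sextic `↦ 4` (CM torus).
[cite: MoonenZarhin1999LowDim, §2 (2.3) and (2.4)] [cite: Ribet1983, Thm. 0–1 and Thm. 3] [cite: Ribet1980, §3 (3.7)] -/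
theorem mtRank_hodge_one_of_isSimple_threefold {k : ℕ} (hX : IsSmoothProjective k A.X) (hA : A.IsSimple) (h3 : A.dim = 3) :
    haveI := BettiUniverse.finite hX 1
    (Module.finrank ℚ A.endAlgebra = 1 ∧ (BettiUniverse.hodge exists_isReal_hodgeModel_holds hX 1).mtRank = 22) ∨
      (Module.finrank ℚ A.endAlgebra = 2 ∧ (BettiUniverse.hodge exists_isReal_hodgeModel_holds hX 1).mtRank = 10) ∨
      (Module.finrank ℚ A.endAlgebra = 3 ∧ (BettiUniverse.hodge exists_isReal_hodgeModel_holds hX 1).mtRank = 10) ∨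
      (Module.finrank ℚ A.endAlgebra = 6 ∧ IsOfCMType A ∧ (BettiUniverse.hodge exists_isReal_hodgeModel_holds hX 1).mtRank = 4) := by
  rcases AbelianVariety.finrank_endAlgebra_mem_of_isSimple_threefold hA h3 with h1 | h2 | h3' | h6
  · exact Or.inl ⟨h1, (mtRank_hodge_one_eq_twentytwo_of_threefold_of_finrank_endAlgebra_eq_one hX h3 h1).1⟩
  · exact Or.inr (Or.inl ⟨h2, (mtRank_hodge_one_of_isSimple_threefold_of_finrank_endAlgebra_eq_two hX hA h3 h2).1⟩)
  · exact Or.inr (Or.inr (Or.inl ⟨h3', (mtRank_hodge_one_of_isSimple_threefold_of_finrank_endAlgebra_eq_three hX hA h3 h3').1⟩))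
  · exact Or.inr (Or.inr (Or.inr ⟨h6, isOfCMType_of_isSimple_threefold_of_finrank_endAlgebra_eq_six hA h3 h6,
      (mtRank_hodge_one_of_isSimple_threefold_of_finrank_endAlgebra_eq_six hX hA h3 h6).1⟩))

/-- **Every simple complex abelian threefold has `dim MT(H¹A) ∈ {4, 10, 22}`.** [cite: MoonenZarhin1999LowDim, §2 (2.3)] -/
theorem mtRank_hodge_one_mem_of_isSimple_threefold {k : ℕ} (hX : IsSmoothProjective k A.X) (hA : A.IsSimple) (h3 : A.dim = 3) :
    haveI := BettiUniverse.finite hX 1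
    (BettiUniverse.hodge exists_isReal_hodgeModel_holds hX 1).mtRank = 4 ∨
      (BettiUniverse.hodge exists_isReal_hodgeModel_holds hX 1).mtRank = 10 ∨
      (BettiUniverse.hodge exists_isReal_hodgeModel_holds hX 1).mtRank = 22 := by
  rcases mtRank_hodge_one_of_isSimple_threefold hX hA h3 with ⟨-, h⟩ | ⟨-, h⟩ | ⟨-, h⟩ | ⟨-, -, h⟩
  · exact Or.inr (Or.inr h)
  · exact Or.inr (Or.inl h)
  · exact Or.inr (Or.inl h)
  · exact Or.inl h

/-- **For a simple abelian threefold: `t = 22 ⟺ End⁰A = ℚ`, `t = 4 ⟺ dim_ℚ End⁰A = 6` (CM), and `t = 10 ⟺ dim_ℚ End⁰A ∈ {2, 3}`.**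
[cite: MoonenZarhin1999LowDim, §2 (2.3)] -/
theorem mtRank_hodge_one_iff_of_isSimple_threefold {k : ℕ} (hX : IsSmoothProjective k A.X) (hA : A.IsSimple) (h3 : A.dim = 3) :
    haveI := BettiUniverse.finite hX 1
    ((BettiUniverse.hodge exists_isReal_hodgeModel_holds hX 1).mtRank = 22 ↔ Module.finrank ℚ A.endAlgebra = 1) ∧
      ((BettiUniverse.hodge exists_isReal_hodgeModel_holds hX 1).mtRank = 4 ↔ Module.finrank ℚ A.endAlgebra = 6) ∧
      ((BettiUniverse.hodge exists_isReal_hodgeModel_holds hX 1).mtRank = 10 ↔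
        Module.finrank ℚ A.endAlgebra = 2 ∨ Module.finrank ℚ A.endAlgebra = 3) := by
  rcases mtRank_hodge_one_of_isSimple_threefold hX hA h3 with ⟨h1, h⟩ | ⟨h2, h⟩ | ⟨h3', h⟩ | ⟨h6, -, h⟩ <;>
    exact ⟨⟨fun h' => by omega, fun h' => by omega⟩, ⟨fun h' => by omega, fun h' => by omega⟩,
      ⟨fun h' => by omega, fun h' => by omega⟩⟩

/-- **CM ⟺ `t = 4` for simple abelian threefolds** (`t = dim A + 1` exactly in the CM case). [cite: MoonenZarhin1999LowDim, §2 (2.3) and Prop. (2.5)] -/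
theorem isOfCMType_iff_mtRank_hodge_one_eq_four_of_isSimple_threefold {k : ℕ} (hX : IsSmoothProjective k A.X) (hA : A.IsSimple)
    (h3 : A.dim = 3) :
    haveI := BettiUniverse.finite hX 1
    IsOfCMType A ↔ (BettiUniverse.hodge exists_isReal_hodgeModel_holds hX 1).mtRank = 4 := by
  haveI := BettiUniverse.finite hX 1
  refine ⟨fun hcm => ?_, fun h => ?_⟩
  · have ht := Literature.AlgebraicGeometry.Pohlmann1968.mtRank_hodge_one_eq_of_dim_le_three hX hA (by omega) (by omega) hcm
    rw [ht, h3]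
  · rcases mtRank_hodge_one_of_isSimple_threefold hX hA h3 with ⟨-, h'⟩ | ⟨-, h'⟩ | ⟨-, h'⟩ | ⟨-, hcm, -⟩
    · omega
    · omega
    · omega
    · exact hcm

/-- **HODGE = LEFSCHETZ FOR EVERY SIMPLE COMPLEX ABELIAN THREEFOLD**: `Lie Hg(H¹A) = C(End_Hdg(H¹A)) ∩ 𝔰𝔭(ψ)` for every polarization `ψ`
(Moonen–Zarhin (2.3) with Prop. (2.5): `Hg(X) = Sp_D(V, φ)` in all four cases — `Sp₆`, `U_F`, `R_{F/ℚ} SL₂`, the CM torus — at the level of Lie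
algebras). [cite: MoonenZarhin1999LowDim, §2 (2.3) and Prop. (2.5)] [cite: Milne1999LefschetzClasses, §2 and Summary] -/
theorem hodgeLie_eq_lefschetz_of_isSimple_threefold {k : ℕ} (hX : IsSmoothProjective k A.X) (hA : A.IsSimple) (h3 : A.dim = 3)
    [Module.Finite ℚ (bettiCohomology A.X 1)] (ψ : (BettiUniverse.hodge exists_isReal_hodgeModel_holds hX 1).Polarization) :
    (BettiUniverse.hodge exists_isReal_hodgeModel_holds hX 1).hodgeLie =
      Subalgebra.toSubmodule (Subalgebra.centralizer ℚ
          ((BettiUniverse.hodge exists_isReal_hodgeModel_holds hX 1).endAlg : Set (Module.End ℚ (bettiCohomology A.X 1)))) ⊓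
        ψ.form.skewAdjointSubmodule := by
  rcases AbelianVariety.finrank_endAlgebra_mem_of_isSimple_threefold hA h3 with h1 | h2 | h3' | h6
  · exact hodgeLie_eq_lefschetz_of_threefold_of_finrank_endAlgebra_eq_one hX h3 h1 ψ
  · exact hodgeLie_eq_lefschetz_of_isSimple_threefold_of_finrank_endAlgebra_eq_two hX hA h3 h2 ψ
  · exact hodgeLie_eq_lefschetz_of_isSimple_threefold_of_finrank_endAlgebra_eq_three hX hA h3 h3' ψ
  · exact hodgeLie_eq_lefschetz_of_isSimple_threefold_of_finrank_endAlgebra_eq_six hX hA h3 h6 ψ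

end Summit.HodgeConjecture.CorCM

end
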